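import Summits.BirchSwinnertonDyer.BirchSwinnertonDyer.Theorems.CyclotomicUntwistInertiaOverCyclotomicNine
import Summits.BirchSwinnertonDyer.BirchSwinnertonDyer.Theorems.CyclotomicUntwistCoinvariantEigenvalue
import Literature.NumberTheory.EllipticCurves.AnalyticRankOverNumberFieldArtinProofs
import Literature.NumberTheory.GaloisRepresentations.DirichletCharacterOfGaloisCharacter
import Literature.NumberTheory.Automorphic.BCDTQuadraticTwistCharacters
import HarnessLib

/-!
# Wild inertia at `3` on the principal-series rows — TRANSPORT LAYER: the framed model `VQ` of `V_ℓ(W)`,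
# the twisted representation `(VQ ⊗ ℚ̄_ℓ) ⊗ ψ` and its inertia action through one `τ`
# (print layer (T) of crux child C1, Galois half, file 1 of 2)

Cell `pub/bsd-wall` (D-0145 line `route-BirchSwinnertonDyer-CyclotomicUntwist`), seat `bsd-line-cycu-p3`
(gen 10). THEOREMS ONLY (no definition, no named fact, no `sorry`); helper toward the crux child
C1 = stmt-BirchSwinnertonDyer-27548 (`PSUntwistedLFunctionAtThree`): the bookkeeping half of the discharge of the
K1 lead's Galois binder `hwild` («an inertia element at `3` acts on `V_ℓ(W)` with exact order `3`», lead's file 3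
`uniformRootLaw_of_print`, cycu-p1 g8) — see the companion `CyclotomicUntwistInertiaWildAtThree` for the two
Carayol arguments and the theorem. BSD is not proved by this file; no crux and no child of the route is proved.

WHAT (all folklore linear algebra / unfolding, over the tree's `FramedGaloisRep`, `ContinuousRep`,
`modNCyclotomicCharacter` and the lead's `CyclotomicUntwistInertiaOverCyclotomicNine`):

* §0 reading degrees of reversed characteristic polynomials of automorphisms (`det(1 − fT)` has its
  `T^{dim}`-coefficient `± det f ≠ 0`; `det(1 − fT) = 1 ⟹ dim = 0`); `(u − 1)` injective `∧ u² = 1 ⟹ u = −1`;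
* §1 the Dirichlet characters mod `3` as continuous characters `ψ : Γ_ℚ → ℚ̄_ℓˣ` with the engine's two
  hypotheses (unramified off `3`, Frobenius values), `χ₃ = χ₉ mod 3`, `ψ₃(2) = −1`;
* §2 unfolding `((VQ ⊗ ℚ̄_ℓ) ⊗ ψ)(g) v = ψ(g)·(VQ(g) ⊗ 1)v`, and transport along the equivariant frame
  `ℚ_ℓ² ≅ V_ℓ(W)` (`exists_framedGaloisRep_rationalTate`): `ρ(h) = 1 ⟹ VQ(h) = 1`, `ρ(τ) = −1 ⟹ VQ(τ) = −1`,
  and fixed vectors;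
* §3 on a principal-series row, with `τ ∈ I_𝔓` (`𝔓 ∣ 3`), `χ₉(τ) = 2` and `ψ` factoring through `χ₃`, every
  element of the inertia group of `D_𝔓` acts on `(VQ ⊗ ℚ̄_ℓ) ⊗ ψ` as a power of `τ`
  (`forall_inertia_twist_eq_pow`; the lead's `rationalGaloisRepTate_apply_eq_self_of_mem_inertia_…`: the
  elements of `I_𝔓` fixing `ζ₉` act trivially on `V_ℓ(W)`).

References: [cite: SerreTate1968, §1–§2] · [cite: SilvermanAEC2009, Prop. VII.4.1] · [cite: NeukirchANT1999, Ch. I (10.1)] ·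
[cite: DeligneSerreASENS1974, §4.4].
-/

set_option autoImplicit false
-- single-conjunct summit: `Summit.BirchSwinnertonDyer.BirchSwinnertonDyer.…` repeats the name by design
set_option linter.dupNamespace false

noncomputable section

open scoped NumberField MatrixGroups Matrix
open Polynomial NumberField IsDedekindDomain IsDedekindDomain.HeightOneSpectrum Field
  Rat.HeightOneSpectrum CongruenceSubgroup
  Literature.NumberTheory.GaloisRepresentations Literature.NumberTheory.EllipticCurves
  Literature.NumberTheory.EllipticCurves.ModularForms Literature.NumberTheory.Automorphic.BCDT
  Summit.BirchSwinnertonDyer.Rank1Residual.Additive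
  Summit.BirchSwinnertonDyer.BirchSwinnertonDyer.Theorems.InertiaOverCyclotomicNine

namespace Summit.BirchSwinnertonDyer.BirchSwinnertonDyer.Theorems.InertiaWildAtThreeTransport

/-! ### §0 Reading the degree of a reversed characteristic polynomial -/

section Algebra

variable {K : Type*} [Field K] {V : Type*} [AddCommGroup V] [Module K V] [FiniteDimensional K V]

/-- For an invertible endomorphism `f`: the coefficient of `T^{dim V}` in `det(1 − fT) = f.charpoly.reverse`
is the constant coefficient `± det f ≠ 0` of the characteristic polynomial. [folklore] -/
theorem coeff_reverse_charpoly_finrank_ne_zero (f : Module.End K V) (hf : IsUnit f) :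
    f.charpoly.reverse.coeff (Module.finrank K V) ≠ 0 := by
  have hdet : f.charpoly.coeff 0 ≠ 0 := by
    intro h0
    have hd := LinearMap.det_eq_sign_charpoly_coeff f
    rw [h0, mul_zero] at hd
    exact ((LinearMap.isUnit_iff_isUnit_det f).mp hf).ne_zero hd
  rwa [Polynomial.coeff_reverse, ← LinearMap.charpoly_natDegree f, Polynomial.revAt_le le_rfl, Nat.sub_self]

/-- For an invertible endomorphism `f`: if `det(1 − fT) = 1` then `V = 0` (the reverse of the characteristic
polynomial of an automorphism has degree `dim V`). [folklore] -/
theorem finrank_eq_zero_of_charpoly_reverse_eq_one (f : Module.End K V) (hf : IsUnit f)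
    (h : f.charpoly.reverse = 1) : Module.finrank K V = 0 := by
  by_contra hne
  have hc := coeff_reverse_charpoly_finrank_ne_zero f hf
  rw [h, Polynomial.coeff_one, if_neg hne] at hc
  exact hc rfl

/-- If `u − 1` is injective and `u² = 1` then `u = −1`. [folklore] -/
theorem eq_neg_one_of_sq_eq_one_of_forall {M : Type*} [AddCommGroup M] [Module K M] (u : Module.End K M)
    (hinj : ∀ y : M, u y = y → y = 0) (hsq : u ^ 2 = 1) : u = -1 := by
  refine LinearMap.ext fun y ↦ ?_
  have hz : u (u y + y) = u y + y := by
    rw [map_add, ← Module.End.mul_apply, ← pow_two, hsq, Module.End.one_apply, add_comm]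
  have h0 := hinj _ hz
  rw [LinearMap.neg_apply, Module.End.one_apply]
  exact eq_neg_of_add_eq_zero_left h0

end Algebra

/-! ### §1 The Dirichlet characters mod `3` as characters of `Γ_ℚ` into `ℚ̄_ℓˣ` -/

section Characters

variable (ℓ : ℕ) [Fact ℓ.Prime] (ι : PadicAlgCl ℓ ≃+* ℂ)

/-- A Dirichlet character `ε` mod `3` as a continuous character `ψ : Γ_ℚ → ℚ̄_ℓˣ`, `ψ(σ) = ι⁻¹(ε(χ₃ σ))`
(tree `exists_continuousMonoidHom_apply_eq_dirichlet`), with the two hypotheses of the engine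
`map_reverse_charpoly_toInertiaCoinvariants_twist_eq`: unramified at `p ≠ 3` and `ψ(Frob_p) = ι⁻¹(ε(p))`.
[cite: DeligneSerreASENS1974, §4.4] -/
theorem exists_psi_of_dirichletCharacter_three (ε : DirichletCharacter ℂ 3) :
    ∃ ψ : absoluteGaloisGroup ℚ →ₜ* (PadicAlgCl ℓ)ˣ,
      (∀ σ : absoluteGaloisGroup ℚ, (ψ σ : PadicAlgCl ℓ) = ι.symm (ε (modNCyclotomicCharacter ℚ 3 σ : ZMod 3))) ∧
      (∀ v : HeightOneSpectrum (𝓞 ℚ), ¬ ((primesEquiv v : Nat.Primes) : ℕ) ∣ 3 →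
        ∀ 𝔓 ∈ v.primesAbove, ∀ σ ∈ 𝔓.inertia (absoluteGaloisGroup ℚ), ψ σ = 1) ∧
      (∀ v : HeightOneSpectrum (𝓞 ℚ), ¬ ((primesEquiv v : Nat.Primes) : ℕ) ∣ 3 →
        ∀ 𝔓 ∈ v.primesAbove, ∀ σ : absoluteGaloisGroup ℚ, IsArithFrobAt (𝓞 ℚ) σ 𝔓 →
          (ψ σ : PadicAlgCl ℓ) = ι.symm ((fun n : ℕ ↦ ε (n : ZMod 3)) (primesEquiv v : ℕ))) := by
  haveI : NeZero ((3 : ℕ) : ℚ) := ⟨by norm_num⟩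
  obtain ⟨ψ, hψ⟩ := exists_continuousMonoidHom_apply_eq_dirichlet 3 (ι.symm : ℂ →+* PadicAlgCl ℓ) ε
  refine ⟨ψ, hψ, fun v hv 𝔓 h𝔓 σ hσ ↦ ?_, fun v hv 𝔓 h𝔓 σ hσ ↦ ?_⟩
  · haveI := h𝔓.1
    have hN := Rat.natCast_not_mem_of_mem_primesAbove_of_not_dvd h𝔓 hv
    have h1 := modNCyclotomicCharacter_eq_one_of_mem_inertia (K := ℚ) (N := 3) hN hσ
    ext
    rw [hψ, h1, Units.val_one, map_one, map_one, Units.val_one]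
  · have hN := Rat.natCast_not_mem_of_mem_primesAbove_of_not_dvd h𝔓 hv
    rw [hψ, modNCyclotomicCharacter_eq_residueCard_of_isArithFrobAt h𝔓 hN hσ,
      FramedRep.residueCard_eq_coe_primesEquiv' v]
    rfl

/-- `χ₃(σ) = 1` whenever `χ₉(σ) = 1` (`χ₃ = χ₉ mod 3`). [folklore] -/
theorem modNCyclotomicCharacter_three_eq_one {σ : absoluteGaloisGroup ℚ}
    (h : modNCyclotomicCharacter ℚ 9 σ = 1) : modNCyclotomicCharacter ℚ 3 σ = 1 := by
  haveI : NeZero ((3 : ℕ) : ℚ) := ⟨by norm_num⟩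
  haveI : NeZero ((9 : ℕ) : ℚ) := ⟨by norm_num⟩
  rw [← unitsMap_modNCyclotomicCharacter ℚ (show (3 : ℕ) ∣ 9 by norm_num) σ, h, map_one]

/-- `χ₃(τ) = 2` whenever `χ₉(τ) = 2`. [folklore] -/
theorem modNCyclotomicCharacter_three_eq_two {τ : absoluteGaloisGroup ℚ}
    (h : (modNCyclotomicCharacter ℚ 9 τ : ZMod 9) = 2) : (modNCyclotomicCharacter ℚ 3 τ : ZMod 3) = 2 := by
  haveI : NeZero ((3 : ℕ) : ℚ) := ⟨by norm_num⟩
  haveI : NeZero ((9 : ℕ) : ℚ) := ⟨by norm_num⟩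
  rw [← cast_modNCyclotomicCharacter ℚ (show (3 : ℕ) ∣ 9 by norm_num) τ, h]
  decide

/-- `ψ₃(2) = −1`. [folklore] -/
theorem psiThree_two : psiThree (2 : ZMod 3) = -1 := by
  rw [psiThree_apply, quadraticChar_zmod_three (show (2 : ZMod 3) ≠ 0 by decide),
    if_neg (show (2 : ZMod 3) ≠ 1 by decide)]
  norm_num

end Characters

/-! ### §2 The framed model `VQ` of `V_ℓ(W)` and the twisted representation `(VQ ⊗ ℚ̄_ℓ) ⊗ ψ` -/

section Unfold

variable {ℓ : ℕ} [Fact ℓ.Prime]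

/-- The matrix of a base-changed framed representation is the entrywise image. [folklore] -/
theorem coe_baseChange_apply {G : Type*} [Group G] [TopologicalSpace G] {n : ℕ}
    (ρ : FramedRep G ℚ_[ℓ] n) (g : G) :
    ((ρ.baseChange (algebraMap ℚ_[ℓ] (PadicAlgCl ℓ)) (continuous_algebraMap_padicAlgCl ℓ) g :
        GL (Fin n) (PadicAlgCl ℓ)) : Matrix (Fin n) (Fin n) (PadicAlgCl ℓ)) =
      ((ρ g : GL (Fin n) ℚ_[ℓ]) : Matrix (Fin n) (Fin n) ℚ_[ℓ]).map (algebraMap ℚ_[ℓ] (PadicAlgCl ℓ)) := by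
  rw [FramedRep.baseChange_apply]
  rfl

/-- **The twisted base change acts by `ψ(g) · (VQ g ⊗ 1)`**: unfolding
`FramedGaloisRep.toGaloisRep ((VQ ⊗ ℚ̄_ℓ) ⊗ ψ)` on vectors. [folklore] -/
theorem toGaloisRep_twist_apply (VQ : FramedGaloisRep ℚ ℚ_[ℓ] 2)
    (ψ : absoluteGaloisGroup ℚ →ₜ* (PadicAlgCl ℓ)ˣ) (g : absoluteGaloisGroup ℚ) (v : Fin 2 → PadicAlgCl ℓ) :
    FramedGaloisRep.toGaloisRep ((VQ.baseChange (algebraMap ℚ_[ℓ] (PadicAlgCl ℓ))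
        (continuous_algebraMap_padicAlgCl ℓ)).twist ψ) g v =
      (ψ g : PadicAlgCl ℓ) •
        ((((VQ g : GL (Fin 2) ℚ_[ℓ]) : Matrix (Fin 2) (Fin 2) ℚ_[ℓ]).map (algebraMap ℚ_[ℓ] (PadicAlgCl ℓ))) *ᵥ v) := by
  rw [show FramedGaloisRep.toGaloisRep ((VQ.baseChange (algebraMap ℚ_[ℓ] (PadicAlgCl ℓ))
        (continuous_algebraMap_padicAlgCl ℓ)).twist ψ) g v = _ from
      FramedRep.toContinuousRep_apply_apply _ g v,
    FramedRep.coe_twist_apply, coe_baseChange_apply, Matrix.smul_mulVec]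

/-- If the matrix `VQ(h)` is `1` and `ψ(h) = 1`, the twisted base change acts trivially at `h`. [folklore] -/
theorem toGaloisRep_twist_eq_one (VQ : FramedGaloisRep ℚ ℚ_[ℓ] 2)
    (ψ : absoluteGaloisGroup ℚ →ₜ* (PadicAlgCl ℓ)ˣ) {h : absoluteGaloisGroup ℚ}
    (hV : ((VQ h : GL (Fin 2) ℚ_[ℓ]) : Matrix (Fin 2) (Fin 2) ℚ_[ℓ]) = 1) (hψ : (ψ h : PadicAlgCl ℓ) = 1) :
    FramedGaloisRep.toGaloisRep ((VQ.baseChange (algebraMap ℚ_[ℓ] (PadicAlgCl ℓ))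
        (continuous_algebraMap_padicAlgCl ℓ)).twist ψ) h = 1 := by
  refine LinearMap.ext fun x ↦ ?_
  rw [toGaloisRep_twist_apply, hV, hψ, one_smul, Matrix.map_one _ (map_zero _) (map_one _),
    Matrix.one_mulVec, Module.End.one_apply]

/-- If the matrix `VQ(τ)` is `−1` and `ψ(τ) = −1`, the twisted base change acts trivially at `τ`. [folklore] -/
theorem toGaloisRep_twist_eq_one_of_neg (VQ : FramedGaloisRep ℚ ℚ_[ℓ] 2)
    (ψ : absoluteGaloisGroup ℚ →ₜ* (PadicAlgCl ℓ)ˣ) {τ : absoluteGaloisGroup ℚ}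
    (hV : ((VQ τ : GL (Fin 2) ℚ_[ℓ]) : Matrix (Fin 2) (Fin 2) ℚ_[ℓ]) = -1) (hψ : (ψ τ : PadicAlgCl ℓ) = -1) :
    FramedGaloisRep.toGaloisRep ((VQ.baseChange (algebraMap ℚ_[ℓ] (PadicAlgCl ℓ))
        (continuous_algebraMap_padicAlgCl ℓ)).twist ψ) τ = 1 := by
  refine LinearMap.ext fun x ↦ ?_
  rw [toGaloisRep_twist_apply, hV, hψ, Matrix.map_neg _ (map_neg _), Matrix.map_one _ (map_zero _) (map_one _),
    Matrix.neg_mulVec, Matrix.one_mulVec, smul_neg, neg_smul, one_smul, neg_neg, Module.End.one_apply]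

end Unfold

section Transport

variable (W : WeierstrassCurve ℚ) (ℓ : ℕ) [Fact ℓ.Prime]

/-- From the equivariant frame `ℚ_ℓ² ≅ V_ℓ(W)`: if `ρ(h) = 1` on `V_ℓ(W)` then the matrix `VQ(h)` is `1`.
[folklore] -/
theorem coe_framed_eq_one_of_rationalGaloisRepTate_eq_one {VQ : FramedGaloisRep ℚ ℚ_[ℓ] 2}
    {eV : (Fin 2 → ℚ_[ℓ]) ≃ₗ[ℚ_[ℓ]] W.rationalTateModule ℓ}
    (heV : ∀ (σ : absoluteGaloisGroup ℚ) (x : Fin 2 → ℚ_[ℓ]),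
      eV (FramedRep.toRepresentation VQ σ x) = W.rationalGaloisRepTate ℓ σ (eV x))
    {h : absoluteGaloisGroup ℚ} (hh : W.rationalGaloisRepTate ℓ h = 1) :
    ((VQ h : GL (Fin 2) ℚ_[ℓ]) : Matrix (Fin 2) (Fin 2) ℚ_[ℓ]) = 1 := by
  have hmv : ∀ x : Fin 2 → ℚ_[ℓ], ((VQ h : GL (Fin 2) ℚ_[ℓ]) : Matrix (Fin 2) (Fin 2) ℚ_[ℓ]) *ᵥ x = x :=
    fun x ↦ by
    apply eV.injective
    rw [← FramedRep.toRepresentation_apply_apply, heV, hh, Module.End.one_apply]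
  apply Matrix.toLin'.injective
  rw [Matrix.toLin'_one]
  exact LinearMap.ext fun x ↦ by rw [Matrix.toLin'_apply, LinearMap.id_apply, hmv]

/-- From the equivariant frame: if `ρ(τ) = −1` on `V_ℓ(W)` then the matrix `VQ(τ)` is `−1`. [folklore] -/
theorem coe_framed_eq_neg_one_of_rationalGaloisRepTate_eq_neg_one {VQ : FramedGaloisRep ℚ ℚ_[ℓ] 2}
    {eV : (Fin 2 → ℚ_[ℓ]) ≃ₗ[ℚ_[ℓ]] W.rationalTateModule ℓ}
    (heV : ∀ (σ : absoluteGaloisGroup ℚ) (x : Fin 2 → ℚ_[ℓ]),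
      eV (FramedRep.toRepresentation VQ σ x) = W.rationalGaloisRepTate ℓ σ (eV x))
    {τ : absoluteGaloisGroup ℚ} (hτ : W.rationalGaloisRepTate ℓ τ = -1) :
    ((VQ τ : GL (Fin 2) ℚ_[ℓ]) : Matrix (Fin 2) (Fin 2) ℚ_[ℓ]) = -1 := by
  have hmv : ∀ x : Fin 2 → ℚ_[ℓ], ((VQ τ : GL (Fin 2) ℚ_[ℓ]) : Matrix (Fin 2) (Fin 2) ℚ_[ℓ]) *ᵥ x = -x :=
    fun x ↦ by
    apply eV.injective
    rw [← FramedRep.toRepresentation_apply_apply, heV, hτ, LinearMap.neg_apply, Module.End.one_apply,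
      map_neg]
  apply Matrix.toLin'.injective
  rw [map_neg, Matrix.toLin'_one]
  exact LinearMap.ext fun x ↦ by rw [Matrix.toLin'_apply, LinearMap.neg_apply, LinearMap.id_apply, hmv]

/-- From the equivariant frame: a `ρ(τ)`-fixed vector of `V_ℓ(W)` gives a `VQ(τ) ⊗ 1`-fixed vector of
`ℚ̄_ℓ²`; so if the latter are all zero, so are the former. [folklore] -/
theorem forall_rationalGaloisRepTate_fixed_eq_zero_of_framed {VQ : FramedGaloisRep ℚ ℚ_[ℓ] 2}
    {eV : (Fin 2 → ℚ_[ℓ]) ≃ₗ[ℚ_[ℓ]] W.rationalTateModule ℓ}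
    (heV : ∀ (σ : absoluteGaloisGroup ℚ) (x : Fin 2 → ℚ_[ℓ]),
      eV (FramedRep.toRepresentation VQ σ x) = W.rationalGaloisRepTate ℓ σ (eV x))
    {τ : absoluteGaloisGroup ℚ}
    (h : ∀ v : Fin 2 → PadicAlgCl ℓ,
      ((((VQ τ : GL (Fin 2) ℚ_[ℓ]) : Matrix (Fin 2) (Fin 2) ℚ_[ℓ]).map (algebraMap ℚ_[ℓ] (PadicAlgCl ℓ))) *ᵥ v)
        = v → v = 0)
    (y : W.rationalTateModule ℓ) (hy : W.rationalGaloisRepTate ℓ τ y = y) : y = 0 := by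
  set x : Fin 2 → ℚ_[ℓ] := eV.symm y with hx
  have hxfix : ((VQ τ : GL (Fin 2) ℚ_[ℓ]) : Matrix (Fin 2) (Fin 2) ℚ_[ℓ]) *ᵥ x = x := by
    apply eV.injective
    rw [← FramedRep.toRepresentation_apply_apply, heV, hx, LinearEquiv.apply_symm_apply, hy]
  set v : Fin 2 → PadicAlgCl ℓ := fun i ↦ algebraMap ℚ_[ℓ] (PadicAlgCl ℓ) (x i) with hv
  have hvfix : ((((VQ τ : GL (Fin 2) ℚ_[ℓ]) : Matrix (Fin 2) (Fin 2) ℚ_[ℓ]).map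
      (algebraMap ℚ_[ℓ] (PadicAlgCl ℓ))) *ᵥ v) = v := funext fun i ↦ by
    have hmap := RingHom.map_mulVec (algebraMap ℚ_[ℓ] (PadicAlgCl ℓ))
      ((VQ τ : GL (Fin 2) ℚ_[ℓ]) : Matrix (Fin 2) (Fin 2) ℚ_[ℓ]) x i
    rw [hxfix] at hmap
    exact hmap.symm
  have hv0 : v = 0 := h v hvfix
  have hx0 : x = 0 := by
    funext i
    have hi := congrFun hv0 i
    simp only [hv, Pi.zero_apply, map_eq_zero] at hi
    exact hi
  rw [← LinearEquiv.apply_symm_apply eV y, ← hx, hx0, map_zero]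

end Transport

/-! ### §3 On a principal-series row: the inertia at `3` acts on `(VQ ⊗ ℚ̄_ℓ) ⊗ ψ` through one `τ` -/

section Cyclic

variable (W : WeierstrassCurve ℚ) [W.IsElliptic] [W.IsGloballyMinimal] (ℓ : ℕ) [Fact ℓ.Prime]

/-- **Joint cyclicity of the twisted inertia action.** On a principal-series row, with `τ ∈ I_𝔓` (`𝔓 ∣ 3`),
`χ₉(τ) = 2`, and `ψ` a character of `Γ_ℚ` factoring through `χ₃` (`ψ(σ) = ι⁻¹(ε(χ₃ σ))`): every element
of the inertia group of the decomposition group `D_𝔓` acts on `(VQ ⊗ ℚ̄_ℓ) ⊗ ψ` as a power of `τ` (write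
`i = τ^j h` with `h ∈ I_𝔓` fixing `ζ₉`: `h` acts trivially on `V_ℓ(W)` by the lead's file 2, and `ψ(h) = 1`).
[cite: SilvermanAEC2009, Prop. VII.4.1] [cite: NeukirchANT1999, Ch. I (10.1)] -/
theorem forall_inertia_twist_eq_pow
    (hO6 : ClassO6 W 3) (hev : Even (padicValInt 3 W.minimalDiscriminantInt))
    (hsq : W.minimalDiscriminantInt / 3 ^ padicValInt 3 W.minimalDiscriminantInt % 3 = 1)
    (hℓ : ℓ ≠ 3) (ι : PadicAlgCl ℓ ≃+* ℂ)
    {VQ : FramedGaloisRep ℚ ℚ_[ℓ] 2} {eV : (Fin 2 → ℚ_[ℓ]) ≃ₗ[ℚ_[ℓ]] W.rationalTateModule ℓ}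
    (heV : ∀ (σ : absoluteGaloisGroup ℚ) (x : Fin 2 → ℚ_[ℓ]),
      eV (FramedRep.toRepresentation VQ σ x) = W.rationalGaloisRepTate ℓ σ (eV x))
    (ε : DirichletCharacter ℂ 3) {ψ : absoluteGaloisGroup ℚ →ₜ* (PadicAlgCl ℓ)ˣ}
    (hψ : ∀ σ : absoluteGaloisGroup ℚ, (ψ σ : PadicAlgCl ℓ) = ι.symm (ε (modNCyclotomicCharacter ℚ 3 σ : ZMod 3)))
    {v : HeightOneSpectrum (𝓞 ℚ)} (hv : (3 : 𝓞 ℚ) ∈ v.asIdeal)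
    {𝔓 : Ideal (absIntegers (𝓞 ℚ) ℚ)} (h𝔓 : 𝔓 ∈ v.primesAbove)
    {τ : absoluteGaloisGroup ℚ} (hτ : τ ∈ 𝔓.inertia (absoluteGaloisGroup ℚ))
    (hχτ : (modNCyclotomicCharacter ℚ 9 τ : ZMod 9) = 2) :
    ∀ s ∈ 𝔓.inertia (𝔓.decompositionSubgroup (absoluteGaloisGroup ℚ)), ∃ j : ℕ,
      FramedGaloisRep.toGaloisRep ((VQ.baseChange (algebraMap ℚ_[ℓ] (PadicAlgCl ℓ))
          (continuous_algebraMap_padicAlgCl ℓ)).twist ψ) (s : absoluteGaloisGroup ℚ) =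
        FramedGaloisRep.toGaloisRep ((VQ.baseChange (algebraMap ℚ_[ℓ] (PadicAlgCl ℓ))
          (continuous_algebraMap_padicAlgCl ℓ)).twist ψ) τ ^ j := by
  haveI : NeZero ((3 : ℕ) : ℚ) := ⟨by norm_num⟩
  intro s hs
  have hsI : (s : absoluteGaloisGroup ℚ) ∈ 𝔓.inertia (absoluteGaloisGroup ℚ) := hs
  obtain ⟨j, hj⟩ := exists_coe_eq_two_pow (modNCyclotomicCharacter ℚ 9 (s : absoluteGaloisGroup ℚ))
  refine ⟨j, ?_⟩
  -- `h := (τ^j)⁻¹ * s` lies in `I_𝔓` and fixes `ζ₉`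
  have hhI : (τ ^ (j : ℕ))⁻¹ * (s : absoluteGaloisGroup ℚ) ∈ 𝔓.inertia (absoluteGaloisGroup ℚ) :=
    Subgroup.mul_mem _ (Subgroup.inv_mem _ (Subgroup.pow_mem _ hτ _)) hsI
  have hχh : modNCyclotomicCharacter ℚ 9 ((τ ^ (j : ℕ))⁻¹ * (s : absoluteGaloisGroup ℚ)) = 1 := by
    apply Units.ext
    have h1 : ((modNCyclotomicCharacter ℚ 9 (τ ^ (j : ℕ)) : (ZMod 9)ˣ) : ZMod 9) = 2 ^ (j : ℕ) := by
      rw [map_pow, Units.val_pow_eq_pow_val, hχτ]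
    rw [map_mul, map_inv, Units.val_mul, Units.val_one, hj, ← h1, Units.inv_mul]
  have hWh : W.rationalGaloisRepTate ℓ ((τ ^ (j : ℕ))⁻¹ * (s : absoluteGaloisGroup ℚ)) = 1 :=
    LinearMap.ext fun x ↦
      rationalGaloisRepTate_apply_eq_self_of_mem_inertia_of_modNCyclotomicCharacter_eq_one W hO6 hev hsq ℓ
        hℓ hv h𝔓 hhI hχh x
  have hVh := coe_framed_eq_one_of_rationalGaloisRepTate_eq_one W ℓ heV hWh
  have hψh : (ψ ((τ ^ (j : ℕ))⁻¹ * (s : absoluteGaloisGroup ℚ)) : PadicAlgCl ℓ) = 1 := by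
    rw [hψ, modNCyclotomicCharacter_three_eq_one hχh, Units.val_one, map_one, map_one]
  have hρh := toGaloisRep_twist_eq_one VQ ψ hVh hψh
  have hs_eq : (s : absoluteGaloisGroup ℚ) = τ ^ (j : ℕ) * ((τ ^ (j : ℕ))⁻¹ * (s : absoluteGaloisGroup ℚ)) := by
    rw [mul_inv_cancel_left]
  rw [hs_eq, map_mul, map_pow, hρh, mul_one]

end Cyclic

end Summit.BirchSwinnertonDyer.BirchSwinnertonDyer.Theorems.InertiaWildAtThreeTransport

end
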